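import Mathlib
import Summits.FinalStateConjecture.FinalStateConjecture.Theorems.EternalPapapetrouSchwarzschildExteriorModeRigidityKernels
import HarnessLib

/-!
# Route EternalPapapetrou · SchwarzschildExteriorModeRigidity — band-limited kernels, II

Helper file for item stmt-FinalStateConjecture-10039 (`SchwarzschildExteriorModeRigidity`).

For `0 < ε ≤ R` the difference kernel `k = ker R − ker ε` has Fourier transform
`ψ = b(·/R) − b(·/ε)`, smooth, compactly supported and vanishing on `[-ε, ε]`. Dividing by
`2πiξ` on the Fourier side gives the **Bernstein data** of `k`: a real integrable bounded
antiderivative `Θ` (`Θ' = k`) and a real integrable `m` with `Θ = m ⋆ k`. This is the input of the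
inverse-Bernstein step `sup |G| ≤ ‖m‖₁ sup |∂ₜ G|` of the mode-rigidity argument. [folklore]
-/

set_option linter.dupNamespace false

noncomputable section

namespace Summit.FinalStateConjecture.FinalStateConjecture.Theorems

open MeasureTheory Set Filter Topology Metric FourierTransform Complex Real
open scoped SchwartzMap ComplexConjugate Convolution

namespace EternalPapapetrou.ModeRigidity

/-! ### Division by `2πiξ` of a smooth function vanishing near `0` -/

/-- `divXi g ξ = g ξ / (2πiξ)`, written with a real scalar factor `ξ⁻¹`. [folklore] -/
def divXi (g : ℝ → ℂ) (ξ : ℝ) : ℂ := (ξ⁻¹ : ℝ) • ((2 * π * I)⁻¹ * g ξ)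

/-- `2πiξ · divXi g ξ = g ξ` whenever `g 0 = 0`. [folklore] -/
theorem two_pi_I_mul_divXi {g : ℝ → ℂ} (hg : g 0 = 0) (ξ : ℝ) :
    (2 * π * I * ξ) * divXi g ξ = g ξ := by
  unfold divXi
  by_cases hξ : ξ = 0
  · subst hξ; simp [hg]
  · rw [real_smul, ofReal_inv]
    have h2 : (2 * π * I : ℂ) ≠ 0 := by simp [pi_ne_zero, I_ne_zero]
    have hξ' : (ξ : ℂ) ≠ 0 := ofReal_ne_zero.2 hξ
    field_simp

/-- `divXi g` vanishes where `g` does. [folklore] -/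
theorem divXi_eq_zero {g : ℝ → ℂ} {ξ : ℝ} (h : g ξ = 0) : divXi g ξ = 0 := by
  simp [divXi, h]

/-- If `g` is smooth and vanishes on a neighbourhood `(-δ, δ)` of `0`, then `divXi g` is smooth.
[folklore] -/
theorem contDiff_divXi {g : ℝ → ℂ} (hg : ContDiff ℝ ((⊤ : ℕ∞) : WithTop ℕ∞) g) {δ : ℝ}
    (hδ : 0 < δ) (hvan : ∀ ξ, |ξ| < δ → g ξ = 0) :
    ContDiff ℝ ((⊤ : ℕ∞) : WithTop ℕ∞) (divXi g) := by
  refine contDiff_iff_contDiffAt.2 fun ξ ↦ ?_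
  by_cases hξ : |ξ| < δ
  · -- locally zero
    have hev : divXi g =ᶠ[𝓝 ξ] fun _ ↦ 0 := by
      have hopen : IsOpen {ζ : ℝ | |ζ| < δ} := isOpen_lt continuous_abs continuous_const
      filter_upwards [hopen.mem_nhds hξ] with ζ hζ
      exact divXi_eq_zero (hvan ζ hζ)
    exact (contDiffAt_const (c := (0 : ℂ))).congr_of_eventuallyEq hev
  · have hξ0 : ξ ≠ 0 := by
      intro h; apply hξ; rw [h, abs_zero]; exact hδ
    unfold divXi
    exact ((contDiffAt_inv ℝ hξ0).smul (contDiffAt_const.mul hg.contDiffAt))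

/-- `divXi g` has compact support if `g` has. [folklore] -/
theorem hasCompactSupport_divXi {g : ℝ → ℂ} (hg : HasCompactSupport g) :
    HasCompactSupport (divXi g) :=
  hg.mono fun ξ hξ ↦ by
    contrapose! hξ
    simp only [Function.mem_support, ne_eq, not_not] at hξ ⊢
    exact divXi_eq_zero hξ

/-! ### The Fourier-side data for `0 < ε ≤ R` -/

section Data

variable {ε R : ℝ} (hε : 0 < ε) (hR : 0 < R) (hεR : ε ≤ R)

/-- `ψ = b(·/R) − b(·/ε)` as a function. [folklore] -/
def psiF (ε R : ℝ) (ξ : ℝ) : ℂ := (rbump R ξ : ℂ) - (rbump ε ξ : ℂ)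

include hε hR hεR in
/-- `ψ` vanishes on `[-ε, ε]`. [folklore] -/
theorem psiF_eq_zero_of_le {ξ : ℝ} (hξ : |ξ| ≤ ε) : psiF ε R ξ = 0 := by
  simp [psiF, rbump_eq_one hε hξ, rbump_eq_one hR (hξ.trans hεR)]

include hε hR hεR in
/-- `ψ` vanishes for `2R ≤ |ξ|`. [folklore] -/
theorem psiF_eq_zero_of_ge {ξ : ℝ} (hξ : 2 * R ≤ |ξ|) : psiF ε R ξ = 0 := by
  simp [psiF, rbump_eq_zero hR hξ, rbump_eq_zero hε (by linarith)]

include hε hR hεR in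
/-- If `ψ ξ ≠ 0` then `ε < |ξ| < 2R`. [folklore] -/
theorem lt_of_psiF_ne_zero {ξ : ℝ} (h : psiF ε R ξ ≠ 0) : ε < |ξ| ∧ |ξ| < 2 * R := by
  constructor
  · by_contra h'; exact h (psiF_eq_zero_of_le hε hR hεR (not_lt.1 h'))
  · by_contra h'; exact h (psiF_eq_zero_of_ge hε hR hεR (not_lt.1 h'))

/-- `ψ` is smooth. [folklore] -/
theorem contDiff_psiF (ε R : ℝ) : ContDiff ℝ ((⊤ : ℕ∞) : WithTop ℕ∞) (psiF ε R) :=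
  (contDiff_rbumpC R).sub (contDiff_rbumpC ε)

include hε hR in
/-- `ψ` has compact support. [folklore] -/
theorem hasCompactSupport_psiF : HasCompactSupport (psiF ε R) :=
  (hasCompactSupport_rbumpC hR).sub (hasCompactSupport_rbumpC hε)

/-- The cut-off `χ = b(·/(2R)) (1 − b(2·/ε))`, `= 1` on `supp ψ`, `= 0` near `0`. [folklore] -/
def chiF (ε R : ℝ) (ξ : ℝ) : ℂ := ((rbump (2 * R) ξ * (1 - rbump (ε / 2) ξ) : ℝ) : ℂ)

include hε in
/-- `χ = 1` where `ψ ≠ 0`. [folklore] -/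
theorem chiF_eq_one {ξ : ℝ} (h1 : ε < |ξ|) (h2 : |ξ| < 2 * R) : chiF ε R ξ = 1 := by
  have ha : rbump (2 * R) ξ = 1 := rbump_eq_one (by linarith) h2.le
  have hb : rbump (ε / 2) ξ = 0 := rbump_eq_zero (by linarith) (by linarith)
  simp [chiF, ha, hb]

include hε in
/-- `χ = 0` for `|ξ| ≤ ε/2`. [folklore] -/
theorem chiF_eq_zero {ξ : ℝ} (h : |ξ| ≤ ε / 2) : chiF ε R ξ = 0 := by
  have hb : rbump (ε / 2) ξ = 1 := rbump_eq_one (by linarith) h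
  simp [chiF, hb]

/-- `χ` is smooth. [folklore] -/
theorem contDiff_chiF (ε R : ℝ) : ContDiff ℝ ((⊤ : ℕ∞) : WithTop ℕ∞) (chiF ε R) :=
  ofRealCLM.contDiff.comp ((contDiff_rbump (2 * R)).mul (contDiff_const.sub (contDiff_rbump _)))

include hR in
/-- `χ` has compact support. [folklore] -/
theorem hasCompactSupport_chiF : HasCompactSupport (chiF ε R) := by
  have : HasCompactSupport fun ξ ↦ rbump (2 * R) ξ * (1 - rbump (ε / 2) ξ) :=
    (hasCompactSupport_rbump (by linarith : 0 < 2 * R)).mul_right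
  exact this.comp_left ofReal_zero

/-- `Θ̂ = ψ/(2πiξ)` as a Schwartz function. [folklore] -/
def thetaHat : 𝓢(ℝ, ℂ) :=
  (hasCompactSupport_divXi (hasCompactSupport_psiF hε hR)).toSchwartzMap
    (contDiff_divXi (contDiff_psiF ε R) hε fun _ hξ ↦ psiF_eq_zero_of_le hε hR hεR hξ.le)

/-- `m̂ = χ/(2πiξ)` as a Schwartz function. [folklore] -/
def mHat : 𝓢(ℝ, ℂ) :=
  (hasCompactSupport_divXi (hasCompactSupport_chiF (ε := ε) hR)).toSchwartzMap
    (contDiff_divXi (contDiff_chiF ε R) (half_pos hε) fun _ hξ ↦ chiF_eq_zero hε hξ.le)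

/-- Values of `thetaHat`. [folklore] -/
@[simp] theorem thetaHat_apply (ξ : ℝ) : thetaHat hε hR hεR ξ = divXi (psiF ε R) ξ := rfl

/-- Values of `mHat`. [folklore] -/
@[simp] theorem mHat_apply (ξ : ℝ) : mHat hε hR (ε := ε) ξ = divXi (chiF ε R) ξ := rfl

include hε hR hεR in
/-- The pointwise identity `m̂ ψ = Θ̂`. [folklore] -/
theorem mHat_mul_psiF (ξ : ℝ) : divXi (chiF ε R) ξ * psiF ε R ξ = divXi (psiF ε R) ξ := by
  by_cases h : psiF ε R ξ = 0
  · rw [h, mul_zero, divXi_eq_zero h]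
  · obtain ⟨h1, h2⟩ := lt_of_psiF_ne_zero hε hR hεR h
    unfold divXi
    rw [chiF_eq_one hε h1 h2]
    simp only [real_smul]
    ring

/-- The difference kernel `kS = kerC R − kerC ε` as a Schwartz function. [folklore] -/
def kS : 𝓢(ℝ, ℂ) := kerC R hR - kerC ε hε

/-- `𝓕 kS = ψ`. [folklore] -/
theorem fourier_kS_apply (ξ : ℝ) : (𝓕 (kS hε hR) : 𝓢(ℝ, ℂ)) ξ = psiF ε R ξ := by
  rw [kS, sub_eq_add_neg, FourierTransform.fourier_add, FourierTransform.fourier_neg, fourier_kerC,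
    fourier_kerC]
  simp [psiF, sub_eq_add_neg]

/-- The antiderivative `Θ = 𝓕⁻¹ Θ̂` and the Bernstein multiplier `m = 𝓕⁻¹ m̂`. [folklore] -/
def ThetaS : 𝓢(ℝ, ℂ) := 𝓕⁻ (thetaHat hε hR hεR)

/-- The Bernstein multiplier `m = 𝓕⁻¹ m̂`. [folklore] -/
def mS : 𝓢(ℝ, ℂ) := 𝓕⁻ (mHat hε hR (ε := ε))

/-- **`Θ' = k`** (on the Fourier side: `2πiξ · ψ/(2πiξ) = ψ`). [folklore] -/
theorem deriv_ThetaS (t : ℝ) : deriv (ThetaS hε hR hεR) t = kS hε hR t := by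
  set Θ := ThetaS hε hR hεR with hΘ
  -- `𝓕 (Θ') = ψ = 𝓕 kS` as functions
  have hd : deriv (Θ : ℝ → ℂ) = (SchwartzMap.derivCLM ℝ ℂ Θ : ℝ → ℂ) := by
    funext x; exact (SchwartzMap.derivCLM_apply ℝ Θ x).symm
  have h1 : 𝓕 (deriv (Θ : ℝ → ℂ)) = fun ξ ↦ psiF ε R ξ := by
    rw [Real.fourier_deriv Θ.integrable Θ.differentiable (by rw [hd]; exact SchwartzMap.integrable _)]
    funext ξ
    have h2 : 𝓕 (Θ : ℝ → ℂ) ξ = divXi (psiF ε R) ξ := by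
      rw [← SchwartzMap.fourier_coe, hΘ, ThetaS, fourier_fourierInv_eq, thetaHat_apply]
    rw [h2, smul_eq_mul, two_pi_I_mul_divXi (psiF_eq_zero_of_le hε hR hεR (by simpa using hε.le))]
  have h3 : 𝓕 (kS hε hR : ℝ → ℂ) = fun ξ ↦ psiF ε R ξ := by
    funext ξ; rw [← SchwartzMap.fourier_coe, fourier_kS_apply]
  have h4 : deriv (Θ : ℝ → ℂ) = (kS hε hR : ℝ → ℂ) := by
    have e1 := (SchwartzMap.derivCLM ℝ ℂ Θ).continuous.fourierInv_fourier_eq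
      (SchwartzMap.integrable _) (by rw [← hd, h1, ← h3]; exact (𝓕 (kS hε hR)).integrable)
    have e2 := (kS hε hR).continuous.fourierInv_fourier_eq (kS hε hR).integrable
      (by rw [h3, ← h1, hd]; exact (𝓕 (SchwartzMap.derivCLM ℝ ℂ Θ)).integrable)
    rw [← hd] at e1
    rw [← e1, ← e2, h1, h3]
  exact congrFun h4 t

/-- **`Θ = m ⋆ k`** (on the Fourier side: `m̂ ψ = Θ̂`). [folklore] -/
theorem ThetaS_eq_convolution (t : ℝ) :
    ThetaS hε hR hεR t = ((mS hε hR (ε := ε) : ℝ → ℂ) ⋆[ContinuousLinearMap.mul ℂ ℂ, volume]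
      (kS hε hR : ℝ → ℂ)) t := by
  have h1 : 𝓕 (SchwartzMap.convolution (ContinuousLinearMap.mul ℂ ℂ) (mS hε hR (ε := ε)) (kS hε hR)) =
      thetaHat hε hR hεR := by
    rw [SchwartzMap.fourier_convolution]
    ext ξ
    rw [SchwartzMap.pairing_apply_apply, ContinuousLinearMap.mul_apply', mS, fourier_fourierInv_eq,
      mHat_apply, fourier_kS_apply, thetaHat_apply, mHat_mul_psiF hε hR hεR]
  have h2 : SchwartzMap.convolution (ContinuousLinearMap.mul ℂ ℂ) (mS hε hR (ε := ε)) (kS hε hR) =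
      ThetaS hε hR hεR := by
    have := congrArg (fun f : 𝓢(ℝ, ℂ) ↦ (𝓕⁻ f : 𝓢(ℝ, ℂ))) h1
    simpa [ThetaS] using this
  rw [← h2, SchwartzMap.convolution_apply]

/-- `kS t = ker R t − ker ε t` (real values). [folklore] -/
theorem kS_apply_eq (t : ℝ) : (kS hε hR : ℝ → ℂ) t = ((ker R hR t - ker ε hε t : ℝ) : ℂ) := by
  simp [kS, kerC_eq_ofReal]

include hεR in
/-- **Bernstein data of the difference kernel (real form).** For `0 < ε ≤ R` there are real
integrable `Θ`, `m`, with `Θ` bounded, `Θ' = ker R − ker ε` and `Θ = m ⋆ (ker R − ker ε)`.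
[folklore] -/
theorem bernsteinData :
    ∃ Θ m : ℝ → ℝ, Integrable Θ ∧ Integrable m ∧ (∃ B, ∀ t, ‖Θ t‖ ≤ B) ∧
      (∀ t, HasDerivAt Θ (ker R hR t - ker ε hε t) t) ∧
      (Θ = (m ⋆[ContinuousLinearMap.mul ℝ ℝ, volume] fun t ↦ ker R hR t - ker ε hε t)) := by
  refine ⟨fun t ↦ (ThetaS hε hR hεR t).re, fun t ↦ (mS hε hR (ε := ε) t).re,
    (ThetaS hε hR hεR).integrable.re, (mS hε hR (ε := ε)).integrable.re, ?_, ?_, ?_⟩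
  · refine ⟨SchwartzMap.seminorm ℝ 0 0 (ThetaS hε hR hεR), fun t ↦ ?_⟩
    exact (RCLike.norm_re_le_norm (ThetaS hε hR hεR t)).trans
      (SchwartzMap.norm_le_seminorm ℝ _ t)
  · intro t
    have h1 : HasDerivAt (ThetaS hε hR hεR : ℝ → ℂ) ((kS hε hR : ℝ → ℂ) t) t := by
      rw [← deriv_ThetaS hε hR hεR t]
      exact (ThetaS hε hR hεR).differentiableAt.hasDerivAt
    have h2 : HasDerivAt (fun t ↦ (ThetaS hε hR hεR t).re)
        (Complex.reCLM ((kS hε hR : ℝ → ℂ) t)) t :=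
      Complex.reCLM.hasFDerivAt.comp_hasDerivAt t h1
    rw [kS_apply_eq, Complex.reCLM_apply, ofReal_re] at h2
    exact h2
  · funext t
    rw [ThetaS_eq_convolution, convolution_def, convolution_def]
    simp only [ContinuousLinearMap.mul_apply']
    have hint : Integrable fun s ↦ (mS hε hR (ε := ε) : ℝ → ℂ) s * (kS hε hR : ℝ → ℂ) (t - s) :=
      (mS hε hR (ε := ε)).integrable.mul_bdd (c := SchwartzMap.seminorm ℝ 0 0 (kS hε hR))
        ((kS hε hR).continuous.comp (continuous_const.sub continuous_id)).aestronglyMeasurable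
        (Eventually.of_forall fun s ↦ SchwartzMap.norm_le_seminorm ℝ _ _)
    have h3 := integral_re hint
    simp only [RCLike.re_to_complex] at h3
    rw [← h3]
    congr 1
    funext s
    rw [kS_apply_eq]
    simp [Complex.mul_re]

end Data

end EternalPapapetrou.ModeRigidity

end Summit.FinalStateConjecture.FinalStateConjecture.Theorems
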